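import Summits.NavierStokesRegularity.NavierStokesRegularity.Theses.AxisymmetricExtremality
import Literature.Analysis.FluidPDE.RusinSverakSingularPoint
import Literature.Analysis.FluidPDE.AxisymmetricTypeIBounded
import Literature.Analysis.FluidPDE.SereginSverakAxisymmetric
import Literature.Analysis.FluidPDE.Seregin2022LogSwirlCriterion
import Summits.NavierStokesRegularity.NavierStokesRegularity.Theorems.AxisymmetricExtremalityAxisymmetricKatoGlobalStubOffAxisBoundedOfLocalEnergy
import Summits.NavierStokesRegularity.NavierStokesRegularity.Theorems.AxisymmetricExtremalityAxisymmetricKatoGlobalStubKatoLocalEnergyNearTop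
import Summits.NavierStokesRegularity.NavierStokesRegularity.Theorems.AxisymmetricExtremalityAxisymmetricKatoGlobalStubKatoAxisymSingularPoint
import Summits.NavierStokesRegularity.NavierStokesRegularity.Theorems.AxisymmetricExtremalityAxisymmetricKatoGlobalNoSwirlStratum
import HarnessLib.Audit

/-!
# Strategist s12-g2 sketch — crux `AxisymmetricExtremality.AxisymmetricKatoGlobal`
# (stmt-NavierStokesRegularity-15453): the typed objects of the STRATEGY CENSUS (family `s`, gen 2)

Nothing here is a registered line; these are the signatures the census `STRATEGY-CENSUS-s12.md`
argues about, elaborated so the argument is about precise statements: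

* `ThresholdInstance` (T′) — the WEAKEST replacement of the crux that the route's deciding theorem
  `closes` actually consumes: "no axisymmetric Ḣ^{1/2}-MINIMAL blow-up datum".  Proved here:
  `thresholdInstance_of_crux : AX_H → T′` and `closes_of_thresholdInstance :
  MinimalDatumPFold → PFoldToAxisymmetric → T′ → NavierStokesRegularity` (same pure-logic proof as
  the route's `closes`, so T′ could replace the crux without loss).
* `SmallSwirlEpsilonRegularity` (Δ₁) and `SwirlEvacuatesAxis` (Δ₂) — the best typed 2-piece split
  found; the assembly `axisymmetricKatoGlobal_of_smallSwirl : Δ₁ → Δ₂ → AX_H` is PROVED from the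
  landed stubs of line `registered` (singular point, local energy near the top, off-axis
  boundedness).
* `AxisymLocalRegularity` (S⁺) — the strengthening "interior regularity of axisymmetric suitable
  weak solutions" (Seregin's 2022 local criterion with the log-swirl hypothesis deleted).
-/

noncomputable section

open Set MeasureTheory Filter Topology Function Metric
open scoped ENNReal NNReal
open Literature.Analysis.FluidPDE Literature.Analysis.FunctionSpaces

namespace Summit.NavierStokesRegularity.NavierStokesRegularity.Cruxes.AxisymmetricKatoGlobal.StrategistS12g2

open Summit.NavierStokesRegularity.NavierStokesRegularity.Theses.AxisymmetricExtremality

local notation "ℝ³" => EuclideanSpace ℝ (Fin 3)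

/-! ## 1. The weakest replacement consumed by `closes`: the threshold instance T′ -/

/-- **T′ — no axisymmetric `Ḣ^{1/2}`-minimal blow-up datum.** For every `ν > 0` there is no
Rusin–Šverák minimal blow-up datum (`IsMinimalBlowupDatum ν u₀ g`: `u₀ ∈ L³`, represented by `g`,
weakly divergence free, `‖g‖ = ρ_max`, no global Kato solution) that is axisymmetric. -/
def ThresholdInstance : Prop :=
  ∀ ν : ℝ, 0 < ν → ∀ (u₀ : ℝ³ → ℝ³) (g : HomSobolev ℝ³ (EuclideanSpace ℂ (Fin 3)) (1 / 2 : ℝ)),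
    IsMinimalBlowupDatum ν u₀ g → IsAxisymmetric u₀ → False

/-- The crux implies its threshold instance (trivial specialisation). -/
theorem thresholdInstance_of_crux (h : AxisymmetricKatoGlobal) : ThresholdInstance := by
  intro ν hν u₀ g hmin hax
  obtain ⟨hL3, hrep, hdiv, -, hnot⟩ := hmin
  exact hnot (h ν hν u₀ g hL3 hrep hdiv (fun θ x => hax θ x))

/-- `closes` factors through T′: the route's deciding theorem with the crux replaced by its
threshold instance (verbatim the route's pure-logic proof). -/
theorem closes_of_thresholdInstance (h₂ : MinimalDatumPFold) (h₄ : PFoldToAxisymmetric)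
    (hT : ThresholdInstance) : NavierStokesRegularity := by
  show Literature.NS.NavierStokesExistenceSmoothR3
  intro ν hν u₀ hsm hdiv hdec
  by_contra hno
  obtain ⟨u₁, g, hmin, hax⟩ := h₄ ν hν (h₂ ν hν ⟨u₀, hsm, hdiv, hdec, hno⟩)
  exact hT ν hν u₁ g hmin (fun θ x => hax θ x)

/-! ## 2. The best typed decomposition found: ε-small swirl at the axis -/

/-- **Δ₁ — small-swirl ε-regularity at an axis point (ABSOLUTE constant).** There is a universal
`ε > 0` such that: an axisymmetric Kato solution on `[0,T)`, smooth on `(0,T) × ℝ³`, whose swirl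
`Γ = swirl (u t)` satisfies `|Γ| ≤ ε ν` on a parabolic neighbourhood `[t₀,T) × B(x₀,δ)` of an
axis point `(T, x₀)`, is bounded near `(T, x₀)`.  (The data-level global form is the open crux
`SwirlThreshold.SmallSwirlRegularity`; every small-swirl theorem in print is RELATIVE to other
norms — Lei–Zhang 2017 Thm 1.4, Nowakowski–Zajączkowski 2023 — or asks a modulus `→ 0` at the axis.) -/
def SmallSwirlEpsilonRegularity : Prop :=
  ∃ ε : ℝ, 0 < ε ∧ ∀ ν : ℝ, 0 < ν → ∀ T : ℝ, 0 < T → ∀ (u₀ : ℝ³ → ℝ³) (u : ℝ → ℝ³ → ℝ³),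
    IsKatoSolutionOn T ν u₀ u → ContDiffOn ℝ (⊤ : ℕ∞) (uncurry u) (Ioo 0 T ×ˢ univ) →
    (∀ t ∈ Ioo 0 T, IsAxisymmetric (u t)) →
    ∀ x₀ : ℝ³, cylRadius x₀ = 0 →
      (∃ t₀ ∈ Ioo 0 T, ∃ δ : ℝ, 0 < δ ∧ ∀ t ∈ Ico t₀ T, ∀ x ∈ ball x₀ δ, |swirl (u t) x| ≤ ε * ν) →
      IsBoundedNearTop u T x₀

/-- **Δ₂ — the swirl evacuates every axis point up to the final time.** For an axisymmetric Kato
solution on `[0,T)` from an `L³` datum represented in `Ḣ^{1/2}`, smooth on `(0,T) × ℝ³`: for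
every `ε > 0` and every axis point `x₀` there are `t₀ < T` and `δ > 0` with `|Γ| ≤ ε ν` on
`[t₀,T) × B(x₀,δ)` (uniformly UP TO `T`; for `t < T` fixed this is mere continuity, `Γ = 0` on the
axis).  Strictly weaker than the registered line's `stub_swirlAxisModulus` (log modulus). -/
def SwirlEvacuatesAxis : Prop :=
  ∀ ν : ℝ, 0 < ν → ∀ T : ℝ, 0 < T → ∀ (u₀ : ℝ³ → ℝ³)
    (g : HomSobolev ℝ³ (EuclideanSpace ℂ (Fin 3)) (1 / 2 : ℝ)) (u : ℝ → ℝ³ → ℝ³),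
    g.Represents (Literature.Analysis.FunctionSpaces.EuclideanSpace.complexify ∘ u₀) →
    IsKatoSolutionOn T ν u₀ u → ContDiffOn ℝ (⊤ : ℕ∞) (uncurry u) (Ioo 0 T ×ˢ univ) →
    (∀ t ∈ Ioo 0 T, IsAxisymmetric (u t)) →
    ∀ ε : ℝ, 0 < ε → ∀ x₀ : ℝ³, cylRadius x₀ = 0 →
      ∃ t₀ ∈ Ioo 0 T, ∃ δ : ℝ, 0 < δ ∧ ∀ t ∈ Ico t₀ T, ∀ x ∈ ball x₀ δ, |swirl (u t) x| ≤ ε * ν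

/-- A pointwise bound on the backward cylinder `(T − r², T) × B_r(x_*)` makes the `L^∞` norm of
`uncurry u` on `parabolicCylinder r (T, x_*)` finite. [folklore; as in `Lines/registered.lean`] -/
theorem eLpNorm_parabolicCylinder_lt_top_of_bound {u : ℝ → ℝ³ → ℝ³} {T r K : ℝ} {xs : ℝ³}
    (h : ∀ t ∈ Ioo (T - r ^ 2) T, ∀ x ∈ ball xs r, ‖u t x‖ ≤ K) :
    eLpNorm (uncurry u) ∞ (volume.restrict (parabolicCylinder r (T, xs))) < ∞ := by
  have hmeas : MeasurableSet (parabolicCylinder r ((T, xs) : ℝ × ℝ³)) := by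
    unfold parabolicCylinder
    exact measurableSet_Ioo.prod measurableSet_ball
  have hbound : ∀ᵐ z ∂(volume.restrict (parabolicCylinder r ((T, xs) : ℝ × ℝ³))),
      ‖uncurry u z‖ ≤ K := by
    filter_upwards [ae_restrict_mem hmeas] with z hz
    obtain ⟨ht, hx⟩ := mem_prod.1 hz
    exact h z.1 ht z.2 hx
  rw [eLpNorm_exponent_top]
  exact (eLpNormEssSup_le_of_ae_bound hbound).trans_lt ENNReal.ofReal_lt_top

/-- **The split's assembly, PROVED: Δ₁ → Δ₂ → AX_H.**  By contradiction: no global Kato solution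
⇒ a finite-time smooth axisymmetric Kato solution singular at some `(T, xs)` (landed
`stub_katoAxisymSingularPoint`); off the axis `xs` is bounded near `T` by the landed CKN/KNSS stubs
(`stub_katoLocalEnergyNearTop`, `stub_offAxisBounded_of_localEnergy`); on the axis Δ₂ feeds Δ₁;
boundedness contradicts the singularity. -/
theorem axisymmetricKatoGlobal_of_smallSwirl (h1 : SmallSwirlEpsilonRegularity)
    (h2 : SwirlEvacuatesAxis) : AxisymmetricKatoGlobal := by
  obtain ⟨ε, hε, hreg⟩ := h1
  intro ν hν u₀ g hL3 hrep hdiv hax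
  have hax' : IsAxisymmetric u₀ := fun θ x => hax θ x
  by_contra hng
  obtain ⟨T, hT, xs, u, hK, hsm, haxi, hsing⟩ :=
    Theorems.AxisymmetricKatoGlobal.Registered.stub_katoAxisymSingularPoint ν hν u₀ hL3 hdiv hax' hng
  have hbd : IsBoundedNearTop u T xs := by
    by_cases h0 : cylRadius xs = 0
    · exact hreg ν hν T hT u₀ u hK hsm haxi xs h0
        (h2 ν hν T hT u₀ g u hrep hK hsm haxi ε hε xs h0)
    · obtain ⟨p, hpax, hsw, hloc⟩ :=
        Theorems.AxisymmetricKatoGlobal.Registered.stub_katoLocalEnergyNearTop ν hν T hT u₀ u hK hsm haxi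
      exact Theorems.AxisymmetricKatoGlobal.Registered.stub_offAxisBounded_of_localEnergy ν hν T hT u p
        hsm haxi hsw hloc xs h0
  obtain ⟨r, hr, K, hb⟩ := hbd
  exact absurd (hsing r hr) (eLpNorm_parabolicCylinder_lt_top_of_bound hb).ne

/-! ## 3. The strengthening S⁺: unconditional interior regularity of axisymmetric suitable weak
solutions (Seregin 2022's local statement with the swirl hypothesis deleted) -/

/-- **S⁺ — every axisymmetric suitable weak solution in the unit parabolic cylinder is regular at
the origin** (hypothesis list = `seregin2022_logSwirl_regularAtOrigin` minus the log-swirl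
modulus).  Implies the crux via the landed stubs K/2b′ and the axis transfer; strictly stronger
(local, no datum). -/
def AxisymLocalRegularity : Prop :=
  ∀ (v : ℝ → ℝ³ → ℝ³) (q : ℝ → ℝ³ → ℝ),
    IsSuitableWeakSolutionOn (SereginSverak2009.parCylOpens 0 1) 1 0 v q →
    (∃ C : ℝ≥0, ∀ᵐ t ∂(volume.restrict (Ioo (-1 : ℝ) 0)),
        ∫⁻ x in SereginSverak2009.spaceCyl 0 1, ‖v t x‖ₑ ^ 2 ≤ C) →
    (∃ G : ℝ → ℝ³ → ℝ³ →L[ℝ] ℝ³,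
        HasWeakSpatialGradientOn (SereginSverak2009.parCylOpens 0 1) v G ∧
        ∫⁻ z in SereginSverak2009.parCyl 0 1, ENNReal.ofReal (frobeniusNormSq (G z.1 z.2)) < ∞) →
    (∫⁻ z in SereginSverak2009.parCyl 0 1, ‖q z.1 z.2‖ₑ ^ (3 / 2 : ℝ) < ∞) →
    (∀ t ∈ Ioo (-1 : ℝ) 0, IsAxisymmetric (v t)) →
    (∀ t ∈ Ioo (-1 : ℝ) 0, IsAxisymmetricScalar (q t)) →
    SereginSverak2009.IsRegularAtOrigin v

/-- S⁺ trivially implies Seregin's conditional criterion (sanity of the typing: S⁺ is the criterion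
with one hypothesis fewer). -/
theorem logSwirl_of_axisymLocalRegularity (h : AxisymLocalRegularity) :
    seregin2022_logSwirl_regularAtOrigin := by
  intro v q hsw hE hG hq hax hqax _
  exact h v q hsw hE hG hq hax hqax

/-! ## 4. The no-swirl bypass relocates the summit (kernel-checked) -/

/-- **The "no-swirl bypass" sister crux.** If Clay (A) fails then, for every `ν > 0`, some
`Ḣ^{1/2}`-minimal blow-up datum is axisymmetric AND swirl-free (what a dihedral / `O(2)` Smith
fixed-point upgrade of `MinimalDatumPFold` would deliver).  With it the crux AX_H could be replaced
by its swirl-free stratum, which is a THEOREM (`axisymmetricKatoGlobal_noSwirl_stratum`) — but then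
this statement decides the summit on its own (next theorem): the bypass hides the summit in the
sister crux instead of weakening the route. -/
def MinimalDatumNoSwirl : Prop :=
  ∀ ν : ℝ, 0 < ν → ¬ NavierStokesRegularity →
    ∃ (u₀ : ℝ³ → ℝ³) (g : HomSobolev ℝ³ (EuclideanSpace ℂ (Fin 3)) (1 / 2 : ℝ)),
      IsMinimalBlowupDatum ν u₀ g ∧ IsAxisymmetric u₀ ∧ HasNoSwirl u₀

/-- `MinimalDatumNoSwirl` ALONE implies the summit (pure logic + the landed swirl-free stratum of
the crux): the no-swirl bypass is summit-strength. -/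
theorem summit_of_minimalDatumNoSwirl (h : MinimalDatumNoSwirl) : NavierStokesRegularity := by
  by_contra hS
  obtain ⟨u₀, g, hmin, hax, hsw⟩ := h 1 one_pos hS
  obtain ⟨hL3, -, hdiv, -, hnot⟩ := hmin
  exact hnot (Theorems.AxisymmetricKatoGlobal.NoSwirlStratum.axisymmetricKatoGlobal_noSwirl_stratum
    1 one_pos u₀ hL3 hdiv (fun θ x => hax θ x) hsw)

end Summit.NavierStokesRegularity.NavierStokesRegularity.Cruxes.AxisymmetricKatoGlobal.StrategistS12g2

end
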